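/-
Copyright (c) 2026 the pub-hodgecm-mathlib formalisation cell (harness21).  Prover seat hodgecm-mathlib-LH4-p09 (g8), req620 Track A «(D-RAM) FOUR-FRAME» squad
(heir LEAD F0P3a-plan (g20) T19-24 «STAGE-1b PRE-SCOPING BY IDLE HANDS: ALLOWED AS SCOPING»; dealer LH4-plan (g12)).  2026-09-04.
-/
import Summits.HodgeConjecture.HodgeConjecture.Theorems.F0P3cDyRamDiagonalCoreHangingSocket    -- ★ B7 socket (LH4-p07 (g3)): `stratum_H_eq` (the H normal form), `finsum_stabiliserWeight_hasAxis_H`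
import Summits.HodgeConjecture.HodgeConjecture.Theorems.F0P3cDyRamLabelledGluedStratumRead       -- ★ p859257 (this seat): `latticeInLevel_diagonal_latt_G1_iff(_of_ne)`; brings ★ p859094 `finsum_mem_sep_eq_ite_of_forall_iff`
import HarnessLib

/-!
# Crux `H413`, line LH4 «(D-RAM) FOUR-FRAME» road — STAGE-1b SCOPING BRICK «(L-model-Hc)»: THE DIAGONAL LEVEL TOKEN ON THE CORE-HANGING STRATUM H `(2ρ, 2ρ, 2ρ)` OFF ITS
# CANCELLATION LOCUS, and the labelled H eighth of a Stage-B table there (over ★ B7)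

Cell `hodgecm-mathlib` (D-0151), FLOOR 0, crux item H413 = `stmt-HodgeConjecture-24833`, route of record `HCCMUnconditional`; squad F0∕P3c∕LH4 (req618∕req620).
THEOREMS ONLY (no `def`, no instance, no notation, no `sorry`, default heartbeats); lane `--supports stmt-HodgeConjecture-24833 --as helper` (count-neutral).
Consumers: the producers of the labelled Stage-B tables of the STAGE-1b type-(1) level laws.  ★ B7 `stratum_H_eq` writes the core-hanging stratum H as the glued normal form AT
`s = 0`: `latt[[1,0,0],[x,ϖ^ρ,0],[xζ+y″,ϖ^ρζ,ϖ^{2ρ}]]` with `|x| = |ζ| = |y″| = |xζ + y″| = 1`; so ★ p859257's G1 read applies verbatim with `s = 0`, and off the locus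
`|e₂ − e₁| ≠ |e₂ − e₀|` (for `e = (α−1, β−1, 0)`: `n₁ ≠ n₂`, i.e. off ★ B7's foot regime `n₁ = n₂ = n₃`) the token is constant on the stratum and the labelled H eighth is ★ B7's
two-summand value behind an indicator.  ON the locus the token cuts H by the residue of `xζ(e₂−e₁) + (e₂−e₀)y″` — the producers' table, not here.
* `latticeInLevel_diagonal_latt_H_iff_of_ne` (the read, constant off the locus), HEAD `finsum_stabiliserWeight_stratum_H_sep_latticeInLevel_of_ne`.
HONEST LABEL.  Count-neutral (`--supports`); nothing printed is asserted; pays NO tier-0 row; `HC_CM` is proved only modulo the 7 printed citations (2 remaining named inputs: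
hLiu418 = `stmt-HodgeConjecture-24832`, h413 = `stmt-HodgeConjecture-24833`) until rung 0 closes.

## References
* [Serre1980Trees] J.-P. Serre, *Trees*, Springer (1980), Ch. II §1.1 (lattices, Hermite normal forms).
* [Kottwitz1986BaseChangeUnits] R. E. Kottwitz, *Base change for unit elements of Hecke algebras*, Compositio Math. 60 (1986), §1 pp. 240–241 (lattice counts modulo the torus).
* [Rogawski1990] J. D. Rogawski, *Automorphic Representations of Unitary Groups in Three Variables*, Ann. of Math. Stud. 123 (1990), §4.9 Prop. 4.9.1 (a)(b) p. 55.
-/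

set_option autoImplicit false

noncomputable section

namespace Summit.HodgeConjecture.HodgeConjecture.Cruxes.H413.F0P3cDyRamLabelledCoreHangingStratumRead

open Literature.NumberTheory.Automorphic Literature.NumberTheory.Automorphic.HermitianLattice
open Literature.NumberTheory.Automorphic.UnitaryLatticeTree Literature.NumberTheory.Automorphic.UnitaryThreeFourFrame
open Summit.HodgeConjecture.HodgeConjecture.Cruxes.H413.F0P3cDyRamDiagonalTorusDefs
open Summit.HodgeConjecture.HodgeConjecture.Cruxes.H413.F0P3cDyRamDiagonalStrataDefs
open Summit.HodgeConjecture.HodgeConjecture.Cruxes.H413.F0P3cDyRamDiagonalCoreHangingSocket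
open Summit.HodgeConjecture.HodgeConjecture.Cruxes.H413.F0P3cDyRamFourFrameCensusDefs
open Summit.HodgeConjecture.HodgeConjecture.Cruxes.H413.F0P3cDyRamLabelledSplitStrata
open Summit.HodgeConjecture.HodgeConjecture.Cruxes.H413.F0P3cDyRamLabelledGluedStratumRead
open scoped Valued WithZero Matrix MatrixGroups

section Read

variable {K : Type*} [Field K] [Valued K ℤᵐ⁰]

/-- **THE TOKEN ON THE CORE-HANGING NORMAL FORM, OFF THE LOCUS**: on `latt[[1,0,0],[x,ϖ^ρ,0],[xζ+y″,ϖ^ρζ,ϖ^{2ρ}]]` with `|x| = |ζ| = |y″| = 1` and `|e₂ − e₁| ≠ |e₂ − e₀|`: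
`diag(e)·M ⊆ ϖ^ℓ·M ↔ (∀ i, |e_i| ≤ |ϖ|^ℓ) ∧ |e₁ − e₀| ≤ |ϖ|^{ℓ+ρ} ∧ |e₂ − e₁| ≤ |ϖ|^{ℓ+ρ} ∧ |e₂ − e₁| ≤ |ϖ|^{ℓ+2ρ} ∧ |e₂ − e₀| ≤ |ϖ|^{ℓ+2ρ}` (★ p859257 at `s = 0`).
[cite: Serre1980Trees, II §1.1] [cite: Kottwitz1986BaseChangeUnits, §1 pp. 240–241] -/
theorem latticeInLevel_diagonal_latt_H_iff_of_ne {ϖ : K} (hϖ : ϖ ≠ 0) (ℓ ρ : ℕ) (e : Fin 3 → K) {x ζ y'' : K} (hx : Valued.v x = 1) (hζ : Valued.v ζ = 1)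
    (hy : Valued.v y'' = 1) (hne : Valued.v (e 2 - e 1) ≠ Valued.v (e 2 - e 0)) :
    LatticeInLevel ϖ ℓ (Matrix.diagonal e) (latt (!![1, 0, 0; x, ϖ ^ ρ, 0; x * ζ + y'', ϖ ^ ρ * ζ, ϖ ^ (2 * ρ)] : Matrix (Fin 3) (Fin 3) K)) ↔
      (Valued.v (e 0) ≤ Valued.v ϖ ^ ℓ ∧ Valued.v (e 1) ≤ Valued.v ϖ ^ ℓ ∧ Valued.v (e 2) ≤ Valued.v ϖ ^ ℓ) ∧
        Valued.v (e 1 - e 0) ≤ Valued.v ϖ ^ (ℓ + ρ) ∧ Valued.v (e 2 - e 1) ≤ Valued.v ϖ ^ (ℓ + ρ) ∧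
          (Valued.v (e 2 - e 1) ≤ Valued.v ϖ ^ (ℓ + 2 * ρ) ∧ Valued.v (e 2 - e 0) ≤ Valued.v ϖ ^ (ℓ + 2 * ρ)) := by
  have hy' : Valued.v y'' = Valued.v ϖ ^ 0 := by rw [pow_zero, hy]
  have hne' : Valued.v (e 2 - e 1) ≠ Valued.v (e 2 - e 0) * Valued.v ϖ ^ 0 := by rwa [pow_zero, mul_one]
  have h := latticeInLevel_diagonal_latt_G1_iff_of_ne hϖ ℓ ρ 0 e hx hζ hy' hne'
  simp only [Nat.add_zero, pow_zero, mul_one] at h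
  exact h

end Read

section Table

variable {K : Type} [Field K] [Valued K ℤᵐ⁰] [Fintype 𝓀[K]] {σ : K →+* K} {ϖ : K} {d t : ℕ} {α β : K} {N₀ n₁ n₂ n₃ : ℕ} {T : GL (Fin 3) K}

/-- **LABELLED H `(2ρ, 2ρ, 2ρ)` OFF THE CANCELLATION LOCUS** (`ρ ≥ 1`, `|e₂ − e₁| ≠ |e₂ − e₀|`): the label-cut weight sum over the core-hanging stratum is ★ B7's value behind
the constant indicator — `Σᶠ_{M ∈ stratum (2ρ,2ρ,2ρ), diag(e)M ⊆ ϖ^ℓM} stabiliserWeight σ M = [P(e, ℓ, ρ)] · ★ finsum_stabiliserWeight_hasAxis_H`.  At `e = (α−1, β−1, 0)` the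
hypothesis is `n₁ ≠ n₂`, off ★ B7's foot `n₁ = n₂ = n₃`. [cite: Rogawski1990, §4.9 Prop. 4.9.1 (a) p. 55] [cite: Kottwitz1986BaseChangeUnits, §1 pp. 240–241] -/
theorem finsum_stabiliserWeight_stratum_H_sep_latticeInLevel_of_ne (hD : IsRamifiedQuadraticDatum σ ϖ d t) (h2 : Valued.v (2 : K) < 1)
    (hE : IsElementDatum σ ϖ N₀ α β n₁ n₂ n₃) (hN₀ : d ≤ N₀) (hT : (T : Matrix (Fin 3) (Fin 3) K) = Matrix.diagonal ![α, β, 1])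
    (ρ : ℕ) (hρ : 1 ≤ ρ) (ℓ : ℕ) (e : Fin 3 → K) (hne : Valued.v (e 2 - e 1) ≠ Valued.v (e 2 - e 0)) :
    ∑ᶠ M ∈ {M | M ∈ stratum σ ϖ T ![2 * ρ, 2 * ρ, 2 * ρ] ∧ LatticeInLevel ϖ ℓ (Matrix.diagonal e) M}, stabiliserWeight σ M =
      if ((Valued.v (e 0) ≤ Valued.v ϖ ^ ℓ ∧ Valued.v (e 1) ≤ Valued.v ϖ ^ ℓ ∧ Valued.v (e 2) ≤ Valued.v ϖ ^ ℓ) ∧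
          Valued.v (e 1 - e 0) ≤ Valued.v ϖ ^ (ℓ + ρ) ∧ Valued.v (e 2 - e 1) ≤ Valued.v ϖ ^ (ℓ + ρ) ∧
            (Valued.v (e 2 - e 1) ≤ Valued.v ϖ ^ (ℓ + 2 * ρ) ∧ Valued.v (e 2 - e 0) ≤ Valued.v ϖ ^ (ℓ + 2 * ρ))) then
        ((if 2 * ρ ≤ min n₁ (min n₂ n₃) then (((Fintype.card 𝓀[K] : ℚ) - 2) * (Fintype.card 𝓀[K] : ℚ) ^ (2 * ρ - 1)) else 0) +
          (if n₁ = n₂ ∧ n₂ = n₃ ∧ n₁ < 2 * ρ ∧ 2 * ρ - n₁ ≤ n₁ - d + 1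
            then ((Fintype.card 𝓀[K] : ℚ) ^ (2 * ρ - (2 * ρ - n₁ + 1) / 2)) else 0))
      else 0 := by
  classical
  have hvσ : ∀ a, Valued.v (σ a) = Valued.v a := hD.2.1
  have hϖ : Valued.v ϖ = WithZero.exp (-1 : ℤ) := hD.2.2.1
  have hfix : ∀ x : K, σ x = x → x ≠ 0 → ∃ n : ℤ, Valued.v x = WithZero.exp (2 * n) := hD.2.2.2.1
  have hϖ0 : ϖ ≠ 0 := fun h0 => by rw [h0, map_zero] at hϖ; exact WithZero.coe_ne_zero hϖ.symm
  rw [finsum_mem_sep_eq_ite_of_forall_iff (stratum σ ϖ T ![2 * ρ, 2 * ρ, 2 * ρ]) _ _ (fun M hM => by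
    rw [stratum_H_eq hvσ hfix hϖ T hρ] at hM
    obtain ⟨-, -, x, ζ, y'', hx, hζ, hy, -, rfl⟩ := hM
    exact latticeInLevel_diagonal_latt_H_iff_of_ne hϖ0 ℓ ρ e hx hζ hy hne), finsum_stabiliserWeight_hasAxis_H hD h2 hE hN₀ hT ρ hρ]

end Table

end Summit.HodgeConjecture.HodgeConjecture.Cruxes.H413.F0P3cDyRamLabelledCoreHangingStratumRead

end
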